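import Summits.QuantumFields.YangMills.Theorems.BalabanUVNodesN15CovariantTwoGridLineProductDefect
import Summits.QuantumFields.YangMills.Theorems.BalabanUVNodesN15PerCubeGreenTwoGridPairingGeometry
import HarnessLib

/-!
# N15 = NE2, road (c) — PROGRAMME (PC), (PC-E) THE DIVERGENCE FIT o_B, PART 3 OF 3: n15-c∕344's DISPLAYED INPUT `hB` PRODUCED ON THE SITE CARRIERS — the two-grid fit of the
# divergence summand `|η′⁻²(S′_μ(x′) − S′_μ(x′−e′_μ)) − η⁻²(S_μ(πx′) − S_μ(πx′−e_μ))|_{ij} ≤ o_B` from the three letters of the transformed fine bond field (pointwise, step, second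
# difference) under the covariant pairing, with `o_B = O(η)` EXPLICIT (dag-n15-c g33, n15-c∕358)

Cell `pub-ymgap`, seat `pub-ymgap-dag-n15-c` (generation g33; R134 (a) seat, strategy s1 «first missing estimate»; HUMAN RULING D-0062; chair R424 venue).
`bears_on: R4∕N15 · K3⁸ SpineGivenEndpointR13SepCoPHV (stmt-QuantumFields-27366)`; filed `--kind proof --supports stmt-QuantumFields-27366 --as helper` — COUNT-NEUTRAL.
Theorems only, 0 `def`, 0 `sorry`.  Imports BY NAME n15-c∕357 `…CovariantTwoGridLineProductDefect` (`frob_twoGridAd_apply_le`, `frob_adFourPoint_apply_le`, `abs_coordMat_entry_le_of_apply_le`)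
and n15-c∕347 `…PerCubeGreenTwoGridPairingGeometry` (`sc_cell_tdist_le`, `tdist_scBlk'_line_le`, `exists_tdist_le_succ`, `scShift_symm_eq_sub`, `scShift'_symm_eq_sub`; through it n15-c∕345
`norm_sub_kingSec_kingPr_le`, n15-c∕341 `gauged_lineHol_eq_mprod`, `kingSec_sub_unitVec`, n15-a `scBlk_mem_cvSk_of_scChi_ne_zero`).  Nothing in the tree is modified, no landed name
re-declared.

WHAT.  §1 ★★★ `abs_divergenceFit_entry_le` — AT ONE FINE SITE `x′` over the coarse site `y = πx′`, for one unitary gauge `u′`, a unitary fine bond field `U′`, the coarse field the straight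
fine holonomy `U_μ(y) = Π_{t<L^r}U′_μ(σy + te′_μ)` (n15-c∕341), `V′(z) = u′(z)U′_μ(z)u′(z+e′_μ)ᴴ`: from the three letters `‖V′ − 1‖ ≤ η′p`, `‖V′(·+e′_μ) − V′‖ ≤ η′²q`,
`‖V′(·+2e′_μ) − 2V′(·+e′_μ) + V′‖ ≤ η′³c` ALONG THE FINE LINE `σ(y−e_μ) + te′_μ` (`t < 2L^r`) and the four letters of the cell step (`ΔΔ`, three steps) ON THE KING CELL of `x′`:
`|(η′⁻²(Ad_{V′(x′)} − Ad_{V′(x′−e′_μ)}) − η⁻²(Ad_{V(y)} − Ad_{V(y−e_μ)}))_{ij}| ≤ κ_e·(η′⁻²(d+1)(L^r−1)·|m|(2γ + 2β²) + |m|(4η⁻²(L^r)³(αβ + γ) + 2η′⁻²(L^r+1)αβ))` in trace-form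
coordinates (`α = η′p`, `β = η′²q`, `γ = η′³c`; `= κ_e|m|·O(η(c + pq + η′q²))`): n15-c∕357's base-point comparison (the coarse transformed bond variables ARE the line products,
`gauged_lineHol_eq_mprod` + `kingSec_sub_unitVec`) plus King's cell walk `x′ → σ(πx′)` (n15-c∕345) with the four-point step bound of n15-c∕357.
§2 ★★★ `sc_hB_of_letters` — PER CUBE `k` on the (PC) site carriers, in the currency of n15-c∕353: letters 1 and 2 on the points within block-distance `3` of the cube's plateau blocks
`𝔅_k = cvSk k` (353's `hF1f`∕`hstep` verbatim), letter 3 on the points within block-distance `2`; conclusion = n15-c∕344's hypothesis `hB` LITERALLY (the shape carried by 348∕353∕354∕355),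
with `o_B` the explicit expression of §1 — the memberships of the line and cell points from n15-c∕347's geometry (`sc_cell_tdist_le`, `tdist_scBlk'_line_le`).

HONEST FRAMING ∕ LIMITS.  Bookkeeping over DISPLAYED letters; the third letter is the MODEL second-order regularity letter of n15-c∕356 (beyond [B9] (3.35)–(3.36) as printed — see that
file's docstring for why (3.36) does not suffice); nothing of [B9] asserted.  NE2⁺ NOT PRINTED ∕ NOT proved; N15 of record untouched; K3⁸ OPEN; counts of record UNMOVED (typed 28∕28 ·
discharged 8∕27); one finite 𝕋⁴ at fixed ε per index — NOT infinite volume, NOT OS on ℝ⁴, NOT a mass gap, NOT Clay.  Restate-immune (no Theses import).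
-/

set_option autoImplicit false

noncomputable section

open scoped BigOperators Matrix Matrix.Norms.L2Operator
open Finset

namespace Summit.QuantumFields.YangMills.BalabanUVNodes.N15.Gluing

open Literature.MathematicalPhysics.QuantumFieldTheory.Balaban1983to89
open Literature.MathematicalPhysics.QuantumFieldTheory.Balaban1983to89.B5Prop11Plancherel (Tor fine unitVec)
open Literature.MathematicalPhysics.QuantumFieldTheory.Balaban1983to89.B6UnitTorusCarrier (unitTorusGeo)
open Literature.MathematicalPhysics.QuantumFieldTheory.King1986.Torus (blockOf tdistT_triangle tdistT_symm tdistT_self)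
open Summit.QuantumFields.YangMills.BalabanUVNodes.N15.VectorPiece (kingPr)
open Summit.QuantumFields.YangMills.BalabanUVNodes.N15.MatrixSpecies (coordMat basisConst basisConst_nonneg coordMat_sub)
open Summit.QuantumFields.YangMills.BalabanUVNodes.N15.CurvedSpecies (uN_gaugeTransformed_bond_unitary)
open Summit.QuantumFields.YangMills.BalabanUVNodes.N15.CovAvg (mprod mprod_congr kingSec kingSec_sub_unitVec gauged_lineHol_eq_mprod conjTranspose_mprod_mul_self norm_sub_kingSec_kingPr_le
  frob_twoGridAd_apply_le frob_adFourPoint_apply_le abs_coordMat_entry_le_of_apply_le)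

variable {d : ℕ} {L : ℕ} [NeZero L] {mv kk r : ℕ} {hL : Odd L ∧ 1 < L}

/-! ## §0 Small helpers -/

section Helpers

open scoped Matrix.Norms.Frobenius

omit [NeZero L] in
/-- Frobenius norm of `p•P + Q`. [folklore] -/
theorem frob_norm_smul_add_le {mm : Type} [Fintype mm] [DecidableEq mm] {p : ℝ} (hp : 0 ≤ p) (P Q : Matrix mm mm ℂ) : ‖p • P + Q‖ ≤ p * ‖P‖ + ‖Q‖ := by
  refine (norm_add_le _ _).trans ?_
  rw [norm_smul, Real.norm_of_nonneg hp]

end Helpers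

/-- the coordinate matrix is ℝ-linear in the operator (`coordMat_smul` of the `BackgroundLayer` file, restated for this carrier). [folklore] -/
theorem coordMat_smul' {mm : Type} [Fintype mm] [DecidableEq mm] {ι : Type} [Fintype ι] [DecidableEq ι] (e : Matrix mm mm ℂ ≃L[ℝ] (ι → ℝ)) (c : ℝ)
    (T : Matrix mm mm ℂ →L[ℝ] Matrix mm mm ℂ) : coordMat e (c • T) = c • coordMat e T := by
  ext i j
  simp [coordMat, LinearMap.toMatrix'_apply]

omit [NeZero L] in
/-- commuting shifts: `(z + e′_κ) + e′_μ = (z + e′_μ) + e′_κ`. [folklore] -/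
theorem add_unitVec_comm (z : ScX' d L mv kk r hL) (κ μ : Fin (d + 1)) :
    z + unitVec (fine (L ^ r * L ^ kk) (cvM d L mv kk hL)) κ + unitVec (fine (L ^ r * L ^ kk) (cvM d L mv kk hL)) μ =
      z + unitVec (fine (L ^ r * L ^ kk) (cvM d L mv kk hL)) μ + unitVec (fine (L ^ r * L ^ kk) (cvM d L mv kk hL)) κ := add_right_comm _ _ _

/-! ## §1 At one fine site: the divergence fit from the three letters along the line and on the cell -/

section Site

variable {mm : Type} [Fintype mm] [DecidableEq mm] [Nonempty mm] {ι : Type} [Fintype ι] [DecidableEq ι] (e : Matrix mm mm ℂ ≃L[ℝ] (ι → ℝ))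

/-- ★★★ **THE DIVERGENCE-SUMMAND FIT AT A FINE SITE FROM THE THREE LETTERS** (see the module docstring, §1). [cite: Balaban1985BackgroundPropagators, (3.35)–(3.36) p.396, (3.50)–(3.52)
p.400 (shapes); Balaban1985Averaging, (124)–(126) p.36 (pairing: shape); King1986, p.664 (pairing convention)] -/
theorem abs_divergenceFit_entry_le {u' : ScX' d L mv kk r hL → Matrix mm mm ℂ} (hu' : ∀ z, (u' z)ᴴ * u' z = 1)
    {U' : Fin (d + 1) → ScX' d L mv kk r hL → Matrix mm mm ℂ} (hU' : ∀ μ z, (U' μ z)ᴴ * U' μ z = 1) {U : Fin (d + 1) → ScX d L mv kk hL → Matrix mm mm ℂ} (μ : Fin (d + 1))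
    (hpair : ∀ y, U μ y = mprod (fun t => U' μ (kingSec (cvM d L mv kk hL) L kk r y + t • unitVec (fine (L ^ r * L ^ kk) (cvM d L mv kk hL)) μ)) (L ^ r))
    {p q c : ℝ} (hp : 0 ≤ p) (hq : 0 ≤ q) (hc : 0 ≤ c) (x' : ScX' d L mv kk r hL)
    (hline : ∀ t, t < 2 * L ^ r →
      ‖u' (kingSec (cvM d L mv kk hL) L kk r ((scShift d L mv kk hL μ).symm (kingPr L kk r (cvM d L mv kk hL) x')) + t • unitVec (fine (L ^ r * L ^ kk) (cvM d L mv kk hL)) μ) *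
          U' μ (kingSec (cvM d L mv kk hL) L kk r ((scShift d L mv kk hL μ).symm (kingPr L kk r (cvM d L mv kk hL) x')) + t • unitVec (fine (L ^ r * L ^ kk) (cvM d L mv kk hL)) μ) *
          (u' (kingSec (cvM d L mv kk hL) L kk r ((scShift d L mv kk hL μ).symm (kingPr L kk r (cvM d L mv kk hL) x')) + t • unitVec (fine (L ^ r * L ^ kk) (cvM d L mv kk hL)) μ +
            unitVec (fine (L ^ r * L ^ kk) (cvM d L mv kk hL)) μ))ᴴ - 1‖ ≤ ((((L ^ r * L ^ kk : ℕ) : ℝ))⁻¹) * p ∧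
      ‖u' (kingSec (cvM d L mv kk hL) L kk r ((scShift d L mv kk hL μ).symm (kingPr L kk r (cvM d L mv kk hL) x')) + t • unitVec (fine (L ^ r * L ^ kk) (cvM d L mv kk hL)) μ +
            unitVec (fine (L ^ r * L ^ kk) (cvM d L mv kk hL)) μ) *
          U' μ (kingSec (cvM d L mv kk hL) L kk r ((scShift d L mv kk hL μ).symm (kingPr L kk r (cvM d L mv kk hL) x')) + t • unitVec (fine (L ^ r * L ^ kk) (cvM d L mv kk hL)) μ +
            unitVec (fine (L ^ r * L ^ kk) (cvM d L mv kk hL)) μ) *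
          (u' (kingSec (cvM d L mv kk hL) L kk r ((scShift d L mv kk hL μ).symm (kingPr L kk r (cvM d L mv kk hL) x')) + t • unitVec (fine (L ^ r * L ^ kk) (cvM d L mv kk hL)) μ +
            unitVec (fine (L ^ r * L ^ kk) (cvM d L mv kk hL)) μ + unitVec (fine (L ^ r * L ^ kk) (cvM d L mv kk hL)) μ))ᴴ -
        u' (kingSec (cvM d L mv kk hL) L kk r ((scShift d L mv kk hL μ).symm (kingPr L kk r (cvM d L mv kk hL) x')) + t • unitVec (fine (L ^ r * L ^ kk) (cvM d L mv kk hL)) μ) *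
          U' μ (kingSec (cvM d L mv kk hL) L kk r ((scShift d L mv kk hL μ).symm (kingPr L kk r (cvM d L mv kk hL) x')) + t • unitVec (fine (L ^ r * L ^ kk) (cvM d L mv kk hL)) μ) *
          (u' (kingSec (cvM d L mv kk hL) L kk r ((scShift d L mv kk hL μ).symm (kingPr L kk r (cvM d L mv kk hL) x')) + t • unitVec (fine (L ^ r * L ^ kk) (cvM d L mv kk hL)) μ +
            unitVec (fine (L ^ r * L ^ kk) (cvM d L mv kk hL)) μ))ᴴ‖ ≤ ((((L ^ r * L ^ kk : ℕ) : ℝ))⁻¹) ^ 2 * q ∧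
      ‖u' (kingSec (cvM d L mv kk hL) L kk r ((scShift d L mv kk hL μ).symm (kingPr L kk r (cvM d L mv kk hL) x')) + t • unitVec (fine (L ^ r * L ^ kk) (cvM d L mv kk hL)) μ +
            unitVec (fine (L ^ r * L ^ kk) (cvM d L mv kk hL)) μ + unitVec (fine (L ^ r * L ^ kk) (cvM d L mv kk hL)) μ) *
          U' μ (kingSec (cvM d L mv kk hL) L kk r ((scShift d L mv kk hL μ).symm (kingPr L kk r (cvM d L mv kk hL) x')) + t • unitVec (fine (L ^ r * L ^ kk) (cvM d L mv kk hL)) μ +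
            unitVec (fine (L ^ r * L ^ kk) (cvM d L mv kk hL)) μ + unitVec (fine (L ^ r * L ^ kk) (cvM d L mv kk hL)) μ) *
          (u' (kingSec (cvM d L mv kk hL) L kk r ((scShift d L mv kk hL μ).symm (kingPr L kk r (cvM d L mv kk hL) x')) + t • unitVec (fine (L ^ r * L ^ kk) (cvM d L mv kk hL)) μ +
            unitVec (fine (L ^ r * L ^ kk) (cvM d L mv kk hL)) μ + unitVec (fine (L ^ r * L ^ kk) (cvM d L mv kk hL)) μ + unitVec (fine (L ^ r * L ^ kk) (cvM d L mv kk hL)) μ))ᴴ -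
        u' (kingSec (cvM d L mv kk hL) L kk r ((scShift d L mv kk hL μ).symm (kingPr L kk r (cvM d L mv kk hL) x')) + t • unitVec (fine (L ^ r * L ^ kk) (cvM d L mv kk hL)) μ +
            unitVec (fine (L ^ r * L ^ kk) (cvM d L mv kk hL)) μ) *
          U' μ (kingSec (cvM d L mv kk hL) L kk r ((scShift d L mv kk hL μ).symm (kingPr L kk r (cvM d L mv kk hL) x')) + t • unitVec (fine (L ^ r * L ^ kk) (cvM d L mv kk hL)) μ +
            unitVec (fine (L ^ r * L ^ kk) (cvM d L mv kk hL)) μ) *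
          (u' (kingSec (cvM d L mv kk hL) L kk r ((scShift d L mv kk hL μ).symm (kingPr L kk r (cvM d L mv kk hL) x')) + t • unitVec (fine (L ^ r * L ^ kk) (cvM d L mv kk hL)) μ +
            unitVec (fine (L ^ r * L ^ kk) (cvM d L mv kk hL)) μ + unitVec (fine (L ^ r * L ^ kk) (cvM d L mv kk hL)) μ))ᴴ -
        u' (kingSec (cvM d L mv kk hL) L kk r ((scShift d L mv kk hL μ).symm (kingPr L kk r (cvM d L mv kk hL) x')) + t • unitVec (fine (L ^ r * L ^ kk) (cvM d L mv kk hL)) μ +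
            unitVec (fine (L ^ r * L ^ kk) (cvM d L mv kk hL)) μ) *
          U' μ (kingSec (cvM d L mv kk hL) L kk r ((scShift d L mv kk hL μ).symm (kingPr L kk r (cvM d L mv kk hL) x')) + t • unitVec (fine (L ^ r * L ^ kk) (cvM d L mv kk hL)) μ +
            unitVec (fine (L ^ r * L ^ kk) (cvM d L mv kk hL)) μ) *
          (u' (kingSec (cvM d L mv kk hL) L kk r ((scShift d L mv kk hL μ).symm (kingPr L kk r (cvM d L mv kk hL) x')) + t • unitVec (fine (L ^ r * L ^ kk) (cvM d L mv kk hL)) μ +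
            unitVec (fine (L ^ r * L ^ kk) (cvM d L mv kk hL)) μ + unitVec (fine (L ^ r * L ^ kk) (cvM d L mv kk hL)) μ))ᴴ +
        u' (kingSec (cvM d L mv kk hL) L kk r ((scShift d L mv kk hL μ).symm (kingPr L kk r (cvM d L mv kk hL) x')) + t • unitVec (fine (L ^ r * L ^ kk) (cvM d L mv kk hL)) μ) *
          U' μ (kingSec (cvM d L mv kk hL) L kk r ((scShift d L mv kk hL μ).symm (kingPr L kk r (cvM d L mv kk hL) x')) + t • unitVec (fine (L ^ r * L ^ kk) (cvM d L mv kk hL)) μ) *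
          (u' (kingSec (cvM d L mv kk hL) L kk r ((scShift d L mv kk hL μ).symm (kingPr L kk r (cvM d L mv kk hL) x')) + t • unitVec (fine (L ^ r * L ^ kk) (cvM d L mv kk hL)) μ +
            unitVec (fine (L ^ r * L ^ kk) (cvM d L mv kk hL)) μ))ᴴ‖ ≤ ((((L ^ r * L ^ kk : ℕ) : ℝ))⁻¹) ^ 3 * c)
    (hcell : ∀ w : ScX' d L mv kk r hL, kingPr L kk r (cvM d L mv kk hL) (w + unitVec (fine (L ^ r * L ^ kk) (cvM d L mv kk hL)) μ) = kingPr L kk r (cvM d L mv kk hL) x' → ∀ i : Fin (d + 1),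
      ‖u' (w + unitVec (fine (L ^ r * L ^ kk) (cvM d L mv kk hL)) μ + unitVec (fine (L ^ r * L ^ kk) (cvM d L mv kk hL)) i) * U' μ (w + unitVec (fine (L ^ r * L ^ kk) (cvM d L mv kk hL)) μ + unitVec (fine (L ^ r * L ^ kk) (cvM d L mv kk hL)) i) *
          (u' (w + unitVec (fine (L ^ r * L ^ kk) (cvM d L mv kk hL)) μ + unitVec (fine (L ^ r * L ^ kk) (cvM d L mv kk hL)) i + unitVec (fine (L ^ r * L ^ kk) (cvM d L mv kk hL)) μ))ᴴ -
        u' (w + unitVec (fine (L ^ r * L ^ kk) (cvM d L mv kk hL)) μ) * U' μ (w + unitVec (fine (L ^ r * L ^ kk) (cvM d L mv kk hL)) μ) * (u' (w + unitVec (fine (L ^ r * L ^ kk) (cvM d L mv kk hL)) μ + unitVec (fine (L ^ r * L ^ kk) (cvM d L mv kk hL)) μ))ᴴ -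
        u' (w + unitVec (fine (L ^ r * L ^ kk) (cvM d L mv kk hL)) i) * U' μ (w + unitVec (fine (L ^ r * L ^ kk) (cvM d L mv kk hL)) i) * (u' (w + unitVec (fine (L ^ r * L ^ kk) (cvM d L mv kk hL)) i + unitVec (fine (L ^ r * L ^ kk) (cvM d L mv kk hL)) μ))ᴴ +
        u' w * U' μ w * (u' (w + unitVec (fine (L ^ r * L ^ kk) (cvM d L mv kk hL)) μ))ᴴ‖ ≤ ((((L ^ r * L ^ kk : ℕ) : ℝ))⁻¹) ^ 3 * c ∧
      ‖u' (w + unitVec (fine (L ^ r * L ^ kk) (cvM d L mv kk hL)) μ) * U' μ (w + unitVec (fine (L ^ r * L ^ kk) (cvM d L mv kk hL)) μ) * (u' (w + unitVec (fine (L ^ r * L ^ kk) (cvM d L mv kk hL)) μ + unitVec (fine (L ^ r * L ^ kk) (cvM d L mv kk hL)) μ))ᴴ -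
        u' w * U' μ w * (u' (w + unitVec (fine (L ^ r * L ^ kk) (cvM d L mv kk hL)) μ))ᴴ‖ ≤ ((((L ^ r * L ^ kk : ℕ) : ℝ))⁻¹) ^ 2 * q ∧
      ‖u' (w + unitVec (fine (L ^ r * L ^ kk) (cvM d L mv kk hL)) μ + unitVec (fine (L ^ r * L ^ kk) (cvM d L mv kk hL)) i) * U' μ (w + unitVec (fine (L ^ r * L ^ kk) (cvM d L mv kk hL)) μ + unitVec (fine (L ^ r * L ^ kk) (cvM d L mv kk hL)) i) *
          (u' (w + unitVec (fine (L ^ r * L ^ kk) (cvM d L mv kk hL)) μ + unitVec (fine (L ^ r * L ^ kk) (cvM d L mv kk hL)) i + unitVec (fine (L ^ r * L ^ kk) (cvM d L mv kk hL)) μ))ᴴ -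
        u' (w + unitVec (fine (L ^ r * L ^ kk) (cvM d L mv kk hL)) μ) * U' μ (w + unitVec (fine (L ^ r * L ^ kk) (cvM d L mv kk hL)) μ) * (u' (w + unitVec (fine (L ^ r * L ^ kk) (cvM d L mv kk hL)) μ + unitVec (fine (L ^ r * L ^ kk) (cvM d L mv kk hL)) μ))ᴴ‖ ≤ ((((L ^ r * L ^ kk : ℕ) : ℝ))⁻¹) ^ 2 * q ∧
      ‖u' (w + unitVec (fine (L ^ r * L ^ kk) (cvM d L mv kk hL)) i) * U' μ (w + unitVec (fine (L ^ r * L ^ kk) (cvM d L mv kk hL)) i) * (u' (w + unitVec (fine (L ^ r * L ^ kk) (cvM d L mv kk hL)) i + unitVec (fine (L ^ r * L ^ kk) (cvM d L mv kk hL)) μ))ᴴ -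
        u' w * U' μ w * (u' (w + unitVec (fine (L ^ r * L ^ kk) (cvM d L mv kk hL)) μ))ᴴ‖ ≤ ((((L ^ r * L ^ kk : ℕ) : ℝ))⁻¹) ^ 2 * q ∧
      ‖u' (w + unitVec (fine (L ^ r * L ^ kk) (cvM d L mv kk hL)) i + unitVec (fine (L ^ r * L ^ kk) (cvM d L mv kk hL)) μ) * U' μ (w + unitVec (fine (L ^ r * L ^ kk) (cvM d L mv kk hL)) i + unitVec (fine (L ^ r * L ^ kk) (cvM d L mv kk hL)) μ) *
          (u' (w + unitVec (fine (L ^ r * L ^ kk) (cvM d L mv kk hL)) i + unitVec (fine (L ^ r * L ^ kk) (cvM d L mv kk hL)) μ + unitVec (fine (L ^ r * L ^ kk) (cvM d L mv kk hL)) μ))ᴴ -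
        u' (w + unitVec (fine (L ^ r * L ^ kk) (cvM d L mv kk hL)) i) * U' μ (w + unitVec (fine (L ^ r * L ^ kk) (cvM d L mv kk hL)) i) * (u' (w + unitVec (fine (L ^ r * L ^ kk) (cvM d L mv kk hL)) i + unitVec (fine (L ^ r * L ^ kk) (cvM d L mv kk hL)) μ))ᴴ‖ ≤ ((((L ^ r * L ^ kk : ℕ) : ℝ))⁻¹) ^ 2 * q)
    (i j : ι) :
    |((((((L ^ r * L ^ kk : ℕ) : ℝ))⁻¹)⁻¹ * ((((L ^ r * L ^ kk : ℕ) : ℝ))⁻¹)⁻¹) • (coordMat e (ContinuousLinearMap.mulLeftRight ℝ (Matrix mm mm ℂ) (u' x' * U' μ x' * (u' (scShift' d L mv kk r hL μ x'))ᴴ) (u' x' * U' μ x' * (u' (scShift' d L mv kk r hL μ x'))ᴴ)ᴴ) -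
          coordMat e (ContinuousLinearMap.mulLeftRight ℝ (Matrix mm mm ℂ) (u' ((scShift' d L mv kk r hL μ).symm x') * U' μ ((scShift' d L mv kk r hL μ).symm x') * (u' (scShift' d L mv kk r hL μ ((scShift' d L mv kk r hL μ).symm x')))ᴴ)
            (u' ((scShift' d L mv kk r hL μ).symm x') * U' μ ((scShift' d L mv kk r hL μ).symm x') * (u' (scShift' d L mv kk r hL μ ((scShift' d L mv kk r hL μ).symm x')))ᴴ)ᴴ)) -
        (((((L ^ kk : ℕ) : ℝ))⁻¹)⁻¹ * ((((L ^ kk : ℕ) : ℝ))⁻¹)⁻¹) • (coordMat e (ContinuousLinearMap.mulLeftRight ℝ (Matrix mm mm ℂ) (u' (kingSec (cvM d L mv kk hL) L kk r (kingPr L kk r (cvM d L mv kk hL) x')) * U μ (kingPr L kk r (cvM d L mv kk hL) x') * (u' (kingSec (cvM d L mv kk hL) L kk r (scShift d L mv kk hL μ (kingPr L kk r (cvM d L mv kk hL) x'))))ᴴ)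
            (u' (kingSec (cvM d L mv kk hL) L kk r (kingPr L kk r (cvM d L mv kk hL) x')) * U μ (kingPr L kk r (cvM d L mv kk hL) x') * (u' (kingSec (cvM d L mv kk hL) L kk r (scShift d L mv kk hL μ (kingPr L kk r (cvM d L mv kk hL) x'))))ᴴ)ᴴ) -
          coordMat e (ContinuousLinearMap.mulLeftRight ℝ (Matrix mm mm ℂ) (u' (kingSec (cvM d L mv kk hL) L kk r ((scShift d L mv kk hL μ).symm (kingPr L kk r (cvM d L mv kk hL) x'))) * U μ ((scShift d L mv kk hL μ).symm (kingPr L kk r (cvM d L mv kk hL) x')) *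
              (u' (kingSec (cvM d L mv kk hL) L kk r (scShift d L mv kk hL μ ((scShift d L mv kk hL μ).symm (kingPr L kk r (cvM d L mv kk hL) x')))))ᴴ)
            (u' (kingSec (cvM d L mv kk hL) L kk r ((scShift d L mv kk hL μ).symm (kingPr L kk r (cvM d L mv kk hL) x'))) * U μ ((scShift d L mv kk hL μ).symm (kingPr L kk r (cvM d L mv kk hL) x')) *
              (u' (kingSec (cvM d L mv kk hL) L kk r (scShift d L mv kk hL μ ((scShift d L mv kk hL μ).symm (kingPr L kk r (cvM d L mv kk hL) x')))))ᴴ)ᴴ))) i j| ≤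
      @basisConst ι _ (Matrix mm mm ℂ) Matrix.frobeniusNormedAddCommGroup Matrix.frobeniusNormedSpace e *
        (((L ^ r * L ^ kk : ℕ) : ℝ) ^ 2 * (((d + 1 : ℕ) : ℝ) * (((L ^ r - 1 : ℕ) : ℝ) * (Fintype.card mm * (2 * (((((L ^ r * L ^ kk : ℕ) : ℝ))⁻¹) ^ 3 * c) +
            ((((L ^ r * L ^ kk : ℕ) : ℝ))⁻¹) ^ 2 * q * (((((L ^ r * L ^ kk : ℕ) : ℝ))⁻¹) ^ 2 * q) + ((((L ^ r * L ^ kk : ℕ) : ℝ))⁻¹) ^ 2 * q * (((((L ^ r * L ^ kk : ℕ) : ℝ))⁻¹) ^ 2 * q))))) +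
          Fintype.card mm * (4 * ((L ^ kk : ℕ) : ℝ) ^ 2 * ((L ^ r : ℕ) : ℝ) ^ 3 * (((((L ^ r * L ^ kk : ℕ) : ℝ))⁻¹) * p * (((((L ^ r * L ^ kk : ℕ) : ℝ))⁻¹) ^ 2 * q) + ((((L ^ r * L ^ kk : ℕ) : ℝ))⁻¹) ^ 3 * c) +
            2 * (((L ^ r : ℕ) : ℝ) * ((L ^ kk : ℕ) : ℝ)) ^ 2 * ((((L ^ r : ℕ) : ℝ) + 1) * (((((L ^ r * L ^ kk : ℕ) : ℝ))⁻¹) * p) * (((((L ^ r * L ^ kk : ℕ) : ℝ))⁻¹) ^ 2 * q)))) := by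
  -- carriers and numerics
  have hLpos : 0 < L := Nat.pos_of_ne_zero (NeZero.ne L)
  have hN1 : 1 ≤ L ^ r := Nat.one_le_pow _ _ hLpos
  set N : ℕ := L ^ r with hNdef
  set nf : ℝ := ((L ^ r * L ^ kk : ℕ) : ℝ) with hnfdef
  set nc : ℝ := ((L ^ kk : ℕ) : ℝ) with hncdef
  set η' : ℝ := nf⁻¹ with hη'def
  have hnf : nf = (N : ℝ) * nc := by rw [hnfdef, hNdef, hncdef, Nat.cast_mul]
  have hη'0 : 0 ≤ η' := by rw [hη'def]; positivity
  set e1 := unitVec (fine (L ^ r * L ^ kk) (cvM d L mv kk hL)) μ with he1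
  set y := kingPr L kk r (cvM d L mv kk hL) x' with hydef
  set y' := (scShift d L mv kk hL μ).symm y with hy'def
  -- the transformed fine bond variables and the fine line
  set W : ScX' d L mv kk r hL → Matrix mm mm ℂ := fun z => u' z * U' μ z * (u' (z + e1))ᴴ with hW
  have hWu : ∀ z, (W z)ᴴ * W z = 1 := fun z => uN_gaugeTransformed_bond_unitary (scShift' d L mv kk r hL) u' U' hu' hU' μ z
  set T : ℕ → Matrix mm mm ℂ := fun t => W (kingSec (cvM d L mv kk hL) L kk r y' + t • e1) with hT
  -- point identities
  have hσ : kingSec (cvM d L mv kk hL) L kk r y' = kingSec (cvM d L mv kk hL) L kk r y - N • e1 := by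
    rw [hy'def, scShift_symm_eq_sub, kingSec_sub_unitVec]
  have hpt : ∀ s : ℕ, kingSec (cvM d L mv kk hL) L kk r y' + (N + s) • e1 = kingSec (cvM d L mv kk hL) L kk r y + s • e1 := fun s => by
    rw [hσ, add_nsmul]; abel
  have hptN : kingSec (cvM d L mv kk hL) L kk r y' + N • e1 = kingSec (cvM d L mv kk hL) L kk r y := by
    have h := hpt 0; rwa [add_zero, zero_smul, add_zero] at h
  have hptN1 : kingSec (cvM d L mv kk hL) L kk r y' + (N - 1) • e1 = (scShift' d L mv kk r hL μ).symm (kingSec (cvM d L mv kk hL) L kk r y) := by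
    rw [scShift'_symm_eq_sub, ← hptN, add_sub_assoc]
    congr 1
    rw [eq_sub_iff_add_eq, ← succ_nsmul, Nat.sub_add_cancel hN1]
  have hp1 : ∀ t : ℕ, kingSec (cvM d L mv kk hL) L kk r y' + (t + 1) • e1 = kingSec (cvM d L mv kk hL) L kk r y' + t • e1 + e1 := fun t => by
    rw [succ_nsmul, add_assoc]
  have hp2 : ∀ t : ℕ, kingSec (cvM d L mv kk hL) L kk r y' + (t + 2) • e1 = kingSec (cvM d L mv kk hL) L kk r y' + t • e1 + e1 + e1 := fun t => by
    rw [show t + 2 = t + 1 + 1 from rfl, hp1, hp1]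
  -- the letters of the line factors
  have hTu : ∀ t, t < 2 * N → (T t)ᴴ * T t = 1 := fun t _ => hWu _
  have hα : ∀ t, t < 2 * N → ‖T t - 1‖ ≤ η' * p := fun t ht => (hline t ht).1
  have hβ : ∀ t, t + 1 < 2 * N → ‖T (t + 1) - T t‖ ≤ η' ^ 2 * q := fun t ht => by
    have h := (hline t (by omega)).2.1
    simp only [hT, hp1]
    exact h
  have hγ : ∀ t, t + 2 < 2 * N → ‖T (t + 2) - T (t + 1) - (T (t + 1) - T t)‖ ≤ η' ^ 3 * c := fun t ht => by
    have h := (hline t (by omega)).2.2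
    simp only [hT, hp2, hp1]
    have e : W (kingSec (cvM d L mv kk hL) L kk r y' + t • e1 + e1 + e1) - W (kingSec (cvM d L mv kk hL) L kk r y' + t • e1 + e1) -
        (W (kingSec (cvM d L mv kk hL) L kk r y' + t • e1 + e1) - W (kingSec (cvM d L mv kk hL) L kk r y' + t • e1)) =
        W (kingSec (cvM d L mv kk hL) L kk r y' + t • e1 + e1 + e1) - W (kingSec (cvM d L mv kk hL) L kk r y' + t • e1 + e1) -
          W (kingSec (cvM d L mv kk hL) L kk r y' + t • e1 + e1) + W (kingSec (cvM d L mv kk hL) L kk r y' + t • e1) := by abel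
    rw [e]
    exact h
  -- the coarse transformed bond variables ARE the line products (n15-c∕341)
  have hcc : u' (kingSec (cvM d L mv kk hL) L kk r y) * U μ y * (u' (kingSec (cvM d L mv kk hL) L kk r (scShift d L mv kk hL μ y)))ᴴ = mprod (fun t => T (N + t)) N := by
    rw [hpair y, show scShift d L mv kk hL μ y = y + unitVec (fine (L ^ kk) (cvM d L mv kk hL)) μ from rfl, gauged_lineHol_eq_mprod (cvM d L mv kk hL) L kk r hu' U' μ y]
    refine mprod_congr fun t _ => ?_
    simp only [hT, hpt t]
    rfl
  have hdd : u' (kingSec (cvM d L mv kk hL) L kk r y') * U μ y' * (u' (kingSec (cvM d L mv kk hL) L kk r (scShift d L mv kk hL μ y')))ᴴ = mprod T N := by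
    rw [hpair y', show scShift d L mv kk hL μ y' = y' + unitVec (fine (L ^ kk) (cvM d L mv kk hL)) μ from rfl, gauged_lineHol_eq_mprod (cvM d L mv kk hL) L kk r hu' U' μ y']
  -- the fine quantity as a function on fine sites (for a fixed test matrix) and its step on the King cell of `x′`
  have hm0 : (0 : ℝ) ≤ Fintype.card mm := Nat.cast_nonneg _
  have hκ0 := @basisConst_nonneg ι _ (Matrix mm mm ℂ) Matrix.frobeniusNormedAddCommGroup Matrix.frobeniusNormedSpace e
  -- rewrite the left side as ONE coordinate matrix
  rw [inv_inv, inv_inv, ← coordMat_sub, ← coordMat_sub, ← coordMat_smul', ← coordMat_smul', ← coordMat_sub]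
  refine abs_coordMat_entry_le_of_apply_le e _ (by positivity) (fun X => ?_) i j
  -- pointwise Frobenius bound for the test matrix `X`
  set XF := @Norm.norm _ Matrix.frobeniusSeminormedAddCommGroup.toNorm X with hXF
  have hXF0 : 0 ≤ XF := @norm_nonneg _ Matrix.frobeniusSeminormedAddCommGroup.toSeminormedAddGroup X
  set g : ScX' d L mv kk r hL → Matrix mm mm ℂ := fun z => W z * X * (W z)ᴴ - W ((scShift' d L mv kk r hL μ).symm z) * X * (W ((scShift' d L mv kk r hL μ).symm z))ᴴ with hg
  -- (1) the step of `g` on the King cell of `x′`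
  set b1 : ℝ := Fintype.card mm * (2 * (η' ^ 3 * c) + η' ^ 2 * q * (η' ^ 2 * q) + η' ^ 2 * q * (η' ^ 2 * q)) * XF with hb1
  have hb10 : 0 ≤ b1 := by positivity
  have hstepg : ∀ (i : Fin (d + 1)) (z : ScX' d L mv kk r hL), kingPr L kk r (cvM d L mv kk hL) z = kingPr L kk r (cvM d L mv kk hL) x' →
      @Norm.norm _ Matrix.frobeniusSeminormedAddCommGroup.toNorm (g (z + unitVec (fine (L ^ r * L ^ kk) (cvM d L mv kk hL)) i) - g z) ≤ b1 := by
    intro i z hz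
    set w := (scShift' d L mv kk r hL μ).symm z with hwdef
    have hzw : z = w + e1 := by rw [hwdef, scShift'_symm_eq_sub, sub_add_cancel]
    have hw2 : (scShift' d L mv kk r hL μ).symm (z + unitVec (fine (L ^ r * L ^ kk) (cvM d L mv kk hL)) i) = w + unitVec (fine (L ^ r * L ^ kk) (cvM d L mv kk hL)) i := by
      rw [scShift'_symm_eq_sub, hzw, add_right_comm, ← he1, add_sub_cancel_right]
    have hid : g (z + unitVec (fine (L ^ r * L ^ kk) (cvM d L mv kk hL)) i) - g z =
        W (w + e1 + unitVec (fine (L ^ r * L ^ kk) (cvM d L mv kk hL)) i) * X * (W (w + e1 + unitVec (fine (L ^ r * L ^ kk) (cvM d L mv kk hL)) i))ᴴ -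
          W (w + unitVec (fine (L ^ r * L ^ kk) (cvM d L mv kk hL)) i) * X * (W (w + unitVec (fine (L ^ r * L ^ kk) (cvM d L mv kk hL)) i))ᴴ - W (w + e1) * X * (W (w + e1))ᴴ + W w * X * (W w)ᴴ := by
      simp only [hg]
      rw [hw2, ← hwdef, hzw]
      abel
    rw [hid]
    rw [hzw] at hz
    obtain ⟨h3, hq1, hq2, hq3, hq4⟩ := hcell w hz i
    refine (frob_adFourPoint_apply_le (hWu _) (hWu w) X).trans ?_
    have e4 : W (w + e1 + unitVec (fine (L ^ r * L ^ kk) (cvM d L mv kk hL)) i) - W (w + unitVec (fine (L ^ r * L ^ kk) (cvM d L mv kk hL)) i) - W (w + e1) + W w =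
        W (w + e1 + unitVec (fine (L ^ r * L ^ kk) (cvM d L mv kk hL)) i) - W (w + e1) - W (w + unitVec (fine (L ^ r * L ^ kk) (cvM d L mv kk hL)) i) + W w := by abel
    have hΔ : ‖W (w + e1 + unitVec (fine (L ^ r * L ^ kk) (cvM d L mv kk hL)) i) - W (w + unitVec (fine (L ^ r * L ^ kk) (cvM d L mv kk hL)) i) - W (w + e1) + W w‖ ≤ η' ^ 3 * c := by
      rw [e4]; exact h3
    have hab : ‖W (w + e1 + unitVec (fine (L ^ r * L ^ kk) (cvM d L mv kk hL)) i) - W (w + unitVec (fine (L ^ r * L ^ kk) (cvM d L mv kk hL)) i)‖ ≤ η' ^ 2 * q := by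
      rw [he1, add_unitVec_comm w μ i]; exact hq4
    have hXF' : @Norm.norm _ Matrix.frobeniusSeminormedAddCommGroup.toNorm X = XF := rfl
    rw [hXF', hb1]
    gcongr
  have hwalk := @norm_sub_kingSec_kingPr_le d (cvM d L mv kk hL) _ L kk r _ (Matrix mm mm ℂ) Matrix.frobeniusSeminormedAddCommGroup g b1 hb10 x' hstepg
  rw [← hydef] at hwalk
  -- (2) the base-point comparison (n15-c∕357)
  have hbase := frob_twoGridAd_apply_le T hN1 hTu (mul_nonneg hη'0 hp) (by positivity : 0 ≤ η' ^ 2 * q) (by positivity : 0 ≤ η' ^ 3 * c) hα hβ hγ nc X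
  rw [← hcc, ← hdd] at hbase
  -- (3) the splitting of the combination applied to `X`
  have hx₀' : (scShift' d L mv kk r hL μ).symm (kingSec (cvM d L mv kk hL) L kk r y) = kingSec (cvM d L mv kk hL) L kk r y' + (N - 1) • e1 := hptN1.symm
  have happly : ((nf * nf) • (ContinuousLinearMap.mulLeftRight ℝ (Matrix mm mm ℂ) (u' x' * U' μ x' * (u' (scShift' d L mv kk r hL μ x'))ᴴ) (u' x' * U' μ x' * (u' (scShift' d L mv kk r hL μ x'))ᴴ)ᴴ -
        ContinuousLinearMap.mulLeftRight ℝ (Matrix mm mm ℂ) (u' ((scShift' d L mv kk r hL μ).symm x') * U' μ ((scShift' d L mv kk r hL μ).symm x') * (u' (scShift' d L mv kk r hL μ ((scShift' d L mv kk r hL μ).symm x')))ᴴ)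
          (u' ((scShift' d L mv kk r hL μ).symm x') * U' μ ((scShift' d L mv kk r hL μ).symm x') * (u' (scShift' d L mv kk r hL μ ((scShift' d L mv kk r hL μ).symm x')))ᴴ)ᴴ) -
      (nc * nc) • (ContinuousLinearMap.mulLeftRight ℝ (Matrix mm mm ℂ) (u' (kingSec (cvM d L mv kk hL) L kk r y) * U μ y * (u' (kingSec (cvM d L mv kk hL) L kk r (scShift d L mv kk hL μ y)))ᴴ)
          (u' (kingSec (cvM d L mv kk hL) L kk r y) * U μ y * (u' (kingSec (cvM d L mv kk hL) L kk r (scShift d L mv kk hL μ y)))ᴴ)ᴴ -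
        ContinuousLinearMap.mulLeftRight ℝ (Matrix mm mm ℂ) (u' (kingSec (cvM d L mv kk hL) L kk r y') * U μ y' * (u' (kingSec (cvM d L mv kk hL) L kk r (scShift d L mv kk hL μ y')))ᴴ)
          (u' (kingSec (cvM d L mv kk hL) L kk r y') * U μ y' * (u' (kingSec (cvM d L mv kk hL) L kk r (scShift d L mv kk hL μ y')))ᴴ)ᴴ)) X =
      (nf * nf) • (g x' - g (kingSec (cvM d L mv kk hL) L kk r y)) +
        (((N : ℝ) * nc) ^ 2 • (T N * X * (T N)ᴴ - T (N - 1) * X * (T (N - 1))ᴴ) -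
          nc ^ 2 • (u' (kingSec (cvM d L mv kk hL) L kk r y) * U μ y * (u' (kingSec (cvM d L mv kk hL) L kk r (scShift d L mv kk hL μ y)))ᴴ * X * (u' (kingSec (cvM d L mv kk hL) L kk r y) * U μ y * (u' (kingSec (cvM d L mv kk hL) L kk r (scShift d L mv kk hL μ y)))ᴴ)ᴴ -
            u' (kingSec (cvM d L mv kk hL) L kk r y') * U μ y' * (u' (kingSec (cvM d L mv kk hL) L kk r (scShift d L mv kk hL μ y')))ᴴ * X * (u' (kingSec (cvM d L mv kk hL) L kk r y') * U μ y' * (u' (kingSec (cvM d L mv kk hL) L kk r (scShift d L mv kk hL μ y')))ᴴ)ᴴ)) := by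
    have hTN : T N = W (kingSec (cvM d L mv kk hL) L kk r y) := by simp only [hT, hptN]
    have hTN1 : T (N - 1) = W ((scShift' d L mv kk r hL μ).symm (kingSec (cvM d L mv kk hL) L kk r y)) := by simp only [hT, hx₀']
    have eS : ∀ z : ScX' d L mv kk r hL, scShift' d L mv kk r hL μ z = z + e1 := fun z => rfl
    rw [← hnf, hTN, hTN1, sq, sq]
    simp only [sub_apply, smul_apply, ContinuousLinearMap.mulLeftRight_apply, hg, hW, eS]
    simp only [smul_sub]
    abel
  rw [happly]
  -- (4) the two bounds combined
  refine (frob_norm_smul_add_le (mul_nonneg (by positivity) (by positivity) : (0 : ℝ) ≤ nf * nf) _ _).trans ?_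
  calc nf * nf * @Norm.norm _ Matrix.frobeniusSeminormedAddCommGroup.toNorm (g x' - g (kingSec (cvM d L mv kk hL) L kk r y)) +
        @Norm.norm _ Matrix.frobeniusSeminormedAddCommGroup.toNorm (((N : ℝ) * nc) ^ 2 • (T N * X * (T N)ᴴ - T (N - 1) * X * (T (N - 1))ᴴ) -
          nc ^ 2 • (u' (kingSec (cvM d L mv kk hL) L kk r y) * U μ y * (u' (kingSec (cvM d L mv kk hL) L kk r (scShift d L mv kk hL μ y)))ᴴ * X * (u' (kingSec (cvM d L mv kk hL) L kk r y) * U μ y * (u' (kingSec (cvM d L mv kk hL) L kk r (scShift d L mv kk hL μ y)))ᴴ)ᴴ -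
            u' (kingSec (cvM d L mv kk hL) L kk r y') * U μ y' * (u' (kingSec (cvM d L mv kk hL) L kk r (scShift d L mv kk hL μ y')))ᴴ * X * (u' (kingSec (cvM d L mv kk hL) L kk r y') * U μ y' * (u' (kingSec (cvM d L mv kk hL) L kk r (scShift d L mv kk hL μ y')))ᴴ)ᴴ))
      ≤ nf * nf * (((d + 1 : ℕ) : ℝ) * (((L ^ r - 1 : ℕ) : ℝ) * b1)) +
        Fintype.card mm * (4 * nc ^ 2 * (N : ℝ) ^ 3 * (η' * p * (η' ^ 2 * q) + η' ^ 3 * c) + 2 * ((N : ℝ) * nc) ^ 2 * (((N : ℝ) + 1) * (η' * p) * (η' ^ 2 * q))) * XF :=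
        add_le_add (mul_le_mul_of_nonneg_left hwalk (by positivity)) hbase
    _ = _ := by rw [hb1, hNdef, hncdef, hnfdef]; push_cast; ring

end Site

/-! ## §2 Per cube on the (PC) site carriers: n15-c∕344's `hB` PRODUCED -/

section Cubes

variable (hM : ∀ ν, cvM d L mv kk hL ν = 2 * L * L ^ mv) (hm₁ : 2 * L ^ mv ≤ coverMargin L mv) (hfitI : coverMargin L mv - 2 * L ^ mv + (6 * L ^ mv + 1) ≤ L * L ^ mv)
  (hS0 : L * L ^ mv ≤ 2 * L * L ^ mv)

include hM hm₁ hfitI hS0 in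
/-- ★★★ **n15-c∕344's DISPLAYED INPUT `hB` PRODUCED FROM THE THREE LETTERS** (see the module docstring, §2): per cube `k`, unitary fine gauges `u′_k`, a unitary fine bond field `U′`, the
coarse field `U_μ = Π_{t<L^r}U′_μ(σ· + te′_μ)` (covariant pairing), the pointwise letter `p` and the all-direction step letter `q` of the transformed bond variables at the fine sites within
three blocks of the plateau `𝔅_k` (n15-c∕353's `hF1f`∕`hstep` currency) and the second-difference letter `c` at the sites within two blocks ⟹ 344's `hB` with
`o_B = κ_e·(η′⁻²(d+1)(L^r−1)|m|(2γ + 2β²) + |m|(4η⁻²(L^r)³(αβ + γ) + 2η′⁻²(L^r+1)αβ))`, `α = η′p`, `β = η′²q`, `γ = η′³c` — `O(η)`.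
[cite: Balaban1985BackgroundPropagators, (3.35)–(3.36) p.396, (3.50)–(3.52) p.400 (shapes); Balaban1985Averaging, (124)–(126) p.36 (pairing: shape); King1986, p.664 (pairing convention)] -/
theorem sc_hB_of_letters {mm : Type} [Fintype mm] [DecidableEq mm] [Nonempty mm] {ι : Type} [Fintype ι] [DecidableEq ι] (e : Matrix mm mm ℂ ≃L[ℝ] (ι → ℝ))
    (u' : (Fin (d + 1) → ZMod (2 * L)) → ScX' d L mv kk r hL → Matrix mm mm ℂ) (hu' : ∀ k z, (u' k z)ᴴ * u' k z = 1)
    (U' : Fin (d + 1) → ScX' d L mv kk r hL → Matrix mm mm ℂ) (hU' : ∀ μ z, (U' μ z)ᴴ * U' μ z = 1) (U : Fin (d + 1) → ScX d L mv kk hL → Matrix mm mm ℂ)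
    (hpair : ∀ μ y, U μ y = mprod (fun t => U' μ (kingSec (cvM d L mv kk hL) L kk r y + t • unitVec (fine (L ^ r * L ^ kk) (cvM d L mv kk hL)) μ)) (L ^ r))
    {p q c : ℝ} (hp : 0 ≤ p) (hq : 0 ≤ q) (hc : 0 ≤ c)
    (hF1 : ∀ k μ (z : ScX' d L mv kk r hL), (∃ y ∈ cvSk d L mv kk hL k, (unitTorusGeo L kk (cvM d L mv kk hL)).dist (scBlk' d L mv kk r hL z) y ≤ 3) →
      ‖u' k z * U' μ z * (u' k (scShift' d L mv kk r hL μ z))ᴴ - 1‖ ≤ ((((L ^ r * L ^ kk : ℕ) : ℝ))⁻¹) * p)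
    (hF2 : ∀ k κ μ (z : ScX' d L mv kk r hL), (∃ y ∈ cvSk d L mv kk hL k, (unitTorusGeo L kk (cvM d L mv kk hL)).dist (scBlk' d L mv kk r hL z) y ≤ 3) →
      ‖u' k (z + unitVec (fine (L ^ r * L ^ kk) (cvM d L mv kk hL)) κ) * U' μ (z + unitVec (fine (L ^ r * L ^ kk) (cvM d L mv kk hL)) κ) * (u' k ((z + unitVec (fine (L ^ r * L ^ kk) (cvM d L mv kk hL)) κ) + unitVec (fine (L ^ r * L ^ kk) (cvM d L mv kk hL)) μ))ᴴ -
        (u' k z * U' μ z * (u' k (z + unitVec (fine (L ^ r * L ^ kk) (cvM d L mv kk hL)) μ))ᴴ)‖ ≤ ((((L ^ r * L ^ kk : ℕ) : ℝ))⁻¹) ^ 2 * q)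
    (hF3 : ∀ k κ μ (z : ScX' d L mv kk r hL), (∃ y ∈ cvSk d L mv kk hL k, (unitTorusGeo L kk (cvM d L mv kk hL)).dist (scBlk' d L mv kk r hL z) y ≤ 2) →
      ‖u' k (z + unitVec (fine (L ^ r * L ^ kk) (cvM d L mv kk hL)) μ + unitVec (fine (L ^ r * L ^ kk) (cvM d L mv kk hL)) κ) * U' μ (z + unitVec (fine (L ^ r * L ^ kk) (cvM d L mv kk hL)) μ + unitVec (fine (L ^ r * L ^ kk) (cvM d L mv kk hL)) κ) *
          (u' k (z + unitVec (fine (L ^ r * L ^ kk) (cvM d L mv kk hL)) μ + unitVec (fine (L ^ r * L ^ kk) (cvM d L mv kk hL)) κ + unitVec (fine (L ^ r * L ^ kk) (cvM d L mv kk hL)) μ))ᴴ -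
        u' k (z + unitVec (fine (L ^ r * L ^ kk) (cvM d L mv kk hL)) μ) * U' μ (z + unitVec (fine (L ^ r * L ^ kk) (cvM d L mv kk hL)) μ) * (u' k (z + unitVec (fine (L ^ r * L ^ kk) (cvM d L mv kk hL)) μ + unitVec (fine (L ^ r * L ^ kk) (cvM d L mv kk hL)) μ))ᴴ -
        u' k (z + unitVec (fine (L ^ r * L ^ kk) (cvM d L mv kk hL)) κ) * U' μ (z + unitVec (fine (L ^ r * L ^ kk) (cvM d L mv kk hL)) κ) * (u' k (z + unitVec (fine (L ^ r * L ^ kk) (cvM d L mv kk hL)) κ + unitVec (fine (L ^ r * L ^ kk) (cvM d L mv kk hL)) μ))ᴴ +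
        u' k z * U' μ z * (u' k (z + unitVec (fine (L ^ r * L ^ kk) (cvM d L mv kk hL)) μ))ᴴ‖ ≤ ((((L ^ r * L ^ kk : ℕ) : ℝ))⁻¹) ^ 3 * c) :
    ∀ k μ x', scChi d L mv kk hL k (kingPr L kk r (cvM d L mv kk hL) x') ≠ 0 → ∀ i j : ι,
      |((((((L ^ r * L ^ kk : ℕ) : ℝ))⁻¹)⁻¹ * ((((L ^ r * L ^ kk : ℕ) : ℝ))⁻¹)⁻¹) • (coordMat e (ContinuousLinearMap.mulLeftRight ℝ (Matrix mm mm ℂ) (u' k x' * U' μ x' * (u' k (scShift' d L mv kk r hL μ x'))ᴴ) (u' k x' * U' μ x' * (u' k (scShift' d L mv kk r hL μ x'))ᴴ)ᴴ) -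
            coordMat e (ContinuousLinearMap.mulLeftRight ℝ (Matrix mm mm ℂ) (u' k ((scShift' d L mv kk r hL μ).symm x') * U' μ ((scShift' d L mv kk r hL μ).symm x') * (u' k (scShift' d L mv kk r hL μ ((scShift' d L mv kk r hL μ).symm x')))ᴴ)
              (u' k ((scShift' d L mv kk r hL μ).symm x') * U' μ ((scShift' d L mv kk r hL μ).symm x') * (u' k (scShift' d L mv kk r hL μ ((scShift' d L mv kk r hL μ).symm x')))ᴴ)ᴴ)) -
          (((((L ^ kk : ℕ) : ℝ))⁻¹)⁻¹ * ((((L ^ kk : ℕ) : ℝ))⁻¹)⁻¹) • (coordMat e (ContinuousLinearMap.mulLeftRight ℝ (Matrix mm mm ℂ) (u' k (kingSec (cvM d L mv kk hL) L kk r (kingPr L kk r (cvM d L mv kk hL) x')) * U μ (kingPr L kk r (cvM d L mv kk hL) x') * (u' k (kingSec (cvM d L mv kk hL) L kk r (scShift d L mv kk hL μ (kingPr L kk r (cvM d L mv kk hL) x'))))ᴴ)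
              (u' k (kingSec (cvM d L mv kk hL) L kk r (kingPr L kk r (cvM d L mv kk hL) x')) * U μ (kingPr L kk r (cvM d L mv kk hL) x') * (u' k (kingSec (cvM d L mv kk hL) L kk r (scShift d L mv kk hL μ (kingPr L kk r (cvM d L mv kk hL) x'))))ᴴ)ᴴ) -
            coordMat e (ContinuousLinearMap.mulLeftRight ℝ (Matrix mm mm ℂ) (u' k (kingSec (cvM d L mv kk hL) L kk r ((scShift d L mv kk hL μ).symm (kingPr L kk r (cvM d L mv kk hL) x'))) * U μ ((scShift d L mv kk hL μ).symm (kingPr L kk r (cvM d L mv kk hL) x')) *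
                (u' k (kingSec (cvM d L mv kk hL) L kk r (scShift d L mv kk hL μ ((scShift d L mv kk hL μ).symm (kingPr L kk r (cvM d L mv kk hL) x')))))ᴴ)
              (u' k (kingSec (cvM d L mv kk hL) L kk r ((scShift d L mv kk hL μ).symm (kingPr L kk r (cvM d L mv kk hL) x'))) * U μ ((scShift d L mv kk hL μ).symm (kingPr L kk r (cvM d L mv kk hL) x')) *
                (u' k (kingSec (cvM d L mv kk hL) L kk r (scShift d L mv kk hL μ ((scShift d L mv kk hL μ).symm (kingPr L kk r (cvM d L mv kk hL) x')))))ᴴ)ᴴ))) i j| ≤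
        @basisConst ι _ (Matrix mm mm ℂ) Matrix.frobeniusNormedAddCommGroup Matrix.frobeniusNormedSpace e *
          (((L ^ r * L ^ kk : ℕ) : ℝ) ^ 2 * (((d + 1 : ℕ) : ℝ) * (((L ^ r - 1 : ℕ) : ℝ) * (Fintype.card mm * (2 * (((((L ^ r * L ^ kk : ℕ) : ℝ))⁻¹) ^ 3 * c) +
              ((((L ^ r * L ^ kk : ℕ) : ℝ))⁻¹) ^ 2 * q * (((((L ^ r * L ^ kk : ℕ) : ℝ))⁻¹) ^ 2 * q) + ((((L ^ r * L ^ kk : ℕ) : ℝ))⁻¹) ^ 2 * q * (((((L ^ r * L ^ kk : ℕ) : ℝ))⁻¹) ^ 2 * q))))) +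
            Fintype.card mm * (4 * ((L ^ kk : ℕ) : ℝ) ^ 2 * ((L ^ r : ℕ) : ℝ) ^ 3 * (((((L ^ r * L ^ kk : ℕ) : ℝ))⁻¹) * p * (((((L ^ r * L ^ kk : ℕ) : ℝ))⁻¹) ^ 2 * q) + ((((L ^ r * L ^ kk : ℕ) : ℝ))⁻¹) ^ 3 * c) +
              2 * (((L ^ r : ℕ) : ℝ) * ((L ^ kk : ℕ) : ℝ)) ^ 2 * ((((L ^ r : ℕ) : ℝ) + 1) * (((((L ^ r * L ^ kk : ℕ) : ℝ))⁻¹) * p) * (((((L ^ r * L ^ kk : ℕ) : ℝ))⁻¹) ^ 2 * q)))) := by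
  have hLpos : 0 < L := Nat.pos_of_ne_zero (NeZero.ne L)
  have hLr : 0 < L ^ r := pow_pos hLpos r
  intro k μ x' hχ i j
  -- block-distance bookkeeping
  have hB0 : scBlk d L mv kk hL (kingPr L kk r (cvM d L mv kk hL) x') ∈ cvSk d L mv kk hL k := scBlk_mem_cvSk_of_scChi_ne_zero hM hm₁ hfitI hS0 hχ
  have hblk : ∀ z : ScX' d L mv kk r hL, scBlk' d L mv kk r hL z = scBlk d L mv kk hL (kingPr L kk r (cvM d L mv kk hL) z) :=
    fun z => (CovAvg.blockOf_kingPr (L := L) (k := kk) (m := r) (M := cvM d L mv kk hL) z).symm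
  have hmono : ∀ (z : ScX' d L mv kk r hL) (a b : ℝ), a ≤ b → (∃ y ∈ cvSk d L mv kk hL k, (unitTorusGeo L kk (cvM d L mv kk hL)).dist (scBlk' d L mv kk r hL z) y ≤ a) →
      ∃ y ∈ cvSk d L mv kk hL k, (unitTorusGeo L kk (cvM d L mv kk hL)).dist (scBlk' d L mv kk r hL z) y ≤ b := fun z a b hab ⟨y, hy, hd⟩ => ⟨y, hy, hd.trans hab⟩
  -- the fine line `σ(πx′ − e_μ) + te′_μ`, `t < 2L^r`, stays within one block of `B(πx′)`
  have hlineP : ∀ t, t < 2 * L ^ r → ∃ y ∈ cvSk d L mv kk hL k, (unitTorusGeo L kk (cvM d L mv kk hL)).dist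
      (scBlk' d L mv kk r hL (kingSec (cvM d L mv kk hL) L kk r ((scShift d L mv kk hL μ).symm (kingPr L kk r (cvM d L mv kk hL) x')) + t • unitVec (fine (L ^ r * L ^ kk) (cvM d L mv kk hL)) μ)) y ≤ 1 := by
    intro t ht
    refine ⟨_, hB0, ?_⟩
    by_cases hlt : t < L ^ r
    · have e1 : kingSec (cvM d L mv kk hL) L kk r ((scShift d L mv kk hL μ).symm (kingPr L kk r (cvM d L mv kk hL) x')) + t • unitVec (fine (L ^ r * L ^ kk) (cvM d L mv kk hL)) μ =
          kingSec (cvM d L mv kk hL) L kk r (kingPr L kk r (cvM d L mv kk hL) x') + t • unitVec (fine (L ^ r * L ^ kk) (cvM d L mv kk hL)) μ - (L ^ r) • unitVec (fine (L ^ r * L ^ kk) (cvM d L mv kk hL)) μ := by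
        rw [scShift_symm_eq_sub, kingSec_sub_unitVec]; abel
      rw [e1]; exact tdist_scBlk'_line_le μ _ hlt le_rfl
    · have e1 : kingSec (cvM d L mv kk hL) L kk r ((scShift d L mv kk hL μ).symm (kingPr L kk r (cvM d L mv kk hL) x')) + t • unitVec (fine (L ^ r * L ^ kk) (cvM d L mv kk hL)) μ =
          kingSec (cvM d L mv kk hL) L kk r (kingPr L kk r (cvM d L mv kk hL) x') + (t - L ^ r) • unitVec (fine (L ^ r * L ^ kk) (cvM d L mv kk hL)) μ - (0 : ℕ) • unitVec (fine (L ^ r * L ^ kk) (cvM d L mv kk hL)) μ := by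
        rw [scShift_symm_eq_sub, kingSec_sub_unitVec, zero_smul, sub_zero, sub_add_eq_add_sub, sub_eq_iff_eq_add, add_assoc, ← add_nsmul, Nat.sub_add_cancel (le_of_not_gt hlt)]
      rw [e1]; exact tdist_scBlk'_line_le μ _ (by omega) (Nat.zero_le _)
  -- the cell of `x′`: a base point `w` with `π(w + e′_μ) = πx′`
  have hcellP : ∀ w : ScX' d L mv kk r hL, kingPr L kk r (cvM d L mv kk hL) (w + unitVec (fine (L ^ r * L ^ kk) (cvM d L mv kk hL)) μ) = kingPr L kk r (cvM d L mv kk hL) x' →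
      (∃ y ∈ cvSk d L mv kk hL k, (unitTorusGeo L kk (cvM d L mv kk hL)).dist (scBlk' d L mv kk r hL (w + unitVec (fine (L ^ r * L ^ kk) (cvM d L mv kk hL)) μ)) y ≤ 0) ∧
      (∃ y ∈ cvSk d L mv kk hL k, (unitTorusGeo L kk (cvM d L mv kk hL)).dist (scBlk' d L mv kk r hL w) y ≤ 1) ∧
      ∀ i : Fin (d + 1), ∃ y ∈ cvSk d L mv kk hL k, (unitTorusGeo L kk (cvM d L mv kk hL)).dist (scBlk' d L mv kk r hL (w + unitVec (fine (L ^ r * L ^ kk) (cvM d L mv kk hL)) i)) y ≤ 2 := by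
    intro w hw
    have h0 : ∃ y ∈ cvSk d L mv kk hL k, (unitTorusGeo L kk (cvM d L mv kk hL)).dist (scBlk' d L mv kk r hL (w + unitVec (fine (L ^ r * L ^ kk) (cvM d L mv kk hL)) μ)) y ≤ 0 :=
      ⟨_, hB0, by rw [hblk, hw]; exact le_of_eq (tdistT_self _ _)⟩
    have h1 : ∃ y ∈ cvSk d L mv kk hL k, (unitTorusGeo L kk (cvM d L mv kk hL)).dist (scBlk' d L mv kk r hL w) y ≤ 1 := by
      have h := tdist_scBlk'_scShift'_symm_le (d := d) (L := L) (mv := mv) (kk := kk) (r := r) (hL := hL) μ (w + unitVec (fine (L ^ r * L ^ kk) (cvM d L mv kk hL)) μ)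
      rw [scShift'_symm_eq_sub, add_sub_cancel_right] at h
      have h' := exists_tdist_le_succ h h0
      rw [zero_add] at h'
      exact h'
    refine ⟨h0, h1, fun i => ?_⟩
    have h' := exists_tdist_le_succ (tdistT_scBlk'_scShift'_le (d := d) (L := L) (mv := mv) (kk := kk) (r := r) (hL := hL) i w) h1
    norm_num at h'
    exact h'
  refine abs_divergenceFit_entry_le e (hu' k) hU' μ (hpair μ) hp hq hc x' (fun t ht => ?_) (fun w hw i' => ?_) i j
  · have h3 := hmono _ 1 3 (by norm_num) (hlineP t ht)
    have h2 := hmono _ 1 2 (by norm_num) (hlineP t ht)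
    exact ⟨hF1 k μ _ h3, hF2 k μ μ _ h3, hF3 k μ μ _ h2⟩
  · obtain ⟨h0, h1, h2⟩ := hcellP w hw
    exact ⟨hF3 k i' μ w (hmono _ 1 2 (by norm_num) h1), hF2 k μ μ w (hmono _ 1 3 (by norm_num) h1), hF2 k i' μ _ (hmono _ 0 3 (by norm_num) h0), hF2 k i' μ w (hmono _ 1 3 (by norm_num) h1),
      hF2 k μ μ _ (hmono _ 2 3 (by norm_num) (h2 i'))⟩

end Cubes

end Summit.QuantumFields.YangMills.BalabanUVNodes.N15.Gluing

end
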